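import Summits.ResolutionOfSingularities.KangarooAtlas.MizutaniHSchemeExponent
import Summits.ResolutionOfSingularities.KangarooAtlas.MizutaniFrobeniusDescent
import HarnessLib

/-!
# The dual of an arbitrary Hironaka scheme (Mizutani Def. 2.2, Prop. 2.5): `V* = 𝒟_e(V)^⊥`, `H** = H`, `e(H*) = e(H)`

Cell `pub-rosobs`, Mizutani enclosure (seat mizutani-encloser-1, gen 9).  AI-written; *AI review is weaker than
expert review*; NOT a resolution-of-singularities theorem (summit relevance C).

Mizutani 1973, Def. 2.2: for a pair `(V, W)` (`V ⊂ k ⊗_{k^q} W = L_e`), the dual pair is `(V*, W*)` with `W*` the dual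
`k^q`-space and `V* = 𝒟_e(V)^⊥`.  Prop. 2.5: `(V, W)` satisfies (i) `𝒥_e𝒟_e(V) = V` iff `(V*, W*)` satisfies (i*); under (i),
(iii) ⟺ (iii*) and (iv) ⟺ (iv*); «thus, when `e ≥ 1`, we can associate the dual H-scheme `H* = H(V*, W*)` … Evidently
`e(H) = e(H*)` and `H** = H`.»  The tree had this for the `k^{1/q}`-RATIONAL points only (`MizutaniRationalPointDual`,
`MizutaniExtremalDual`: `[c^{1/q}] ↔ [a^{1/q}]`).  This file does it for EVERY subspace / EVERY point of `ℙ^n_k`, in the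
coordinates `X_i^q` of `W` and the dual basis of `W*` (so both `V` and `V*` live in `k^{n+1}`, `⊥` = `orth`):

* `dualForms k p e V = (𝒟_e V)^⊥ = 𝒥_e(V^⊥)` (Lemma 2.3); `jCore_dSpan_dualForms` ((i*) holds ALWAYS); for closed `V`:
  `dSpan_dualForms` (`𝒟_e(V*) = V^⊥`), **`dualForms_dualForms`** (`V** = V`); `dualForms_ne_top_iff` (`V*` is proper iff
  `V ≠ 0`, i.e. iff the scheme is not the whole vector group at level `e`); `finrank_dualForms_add` (`dim V* + dim 𝒟_e V = n + 1`);
* **`dualForms_eq_span_inter_iff`** — (iii) ⟺ (iii*): for closed `V` at level `e + 1`, `V*` is defined over `k^p` iff `V` is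
  (Frobenius descent `MizutaniFrobeniusDescent`);
* the DUAL POINT `dualPoint k p 𝔭 e = qLinPoint e ((L_B)_e(𝔭)^⊥)` — the generic point of the `q`-th-root locus of the linear
  space `ℙ((L_B)_e(𝔭)) ⊂ ℙ^n` spanned by the coefficient vectors of the invariant forms —: `invForms_dualPoint`
  (`(L_B)_e(𝔭*) = V*`), `isPoint_dualPoint_iff`, `exponentLE_dualPoint`, **`dualPoint_dualPoint`** (`𝔭** = genPoint k p 𝔭 e`, the
  most generic point of `B(𝔭)`: `H** = H`, `bIdeal_dualPoint_dualPoint`), **`exponent_dualPoint`** (`e(H*) = e(H)` when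
  `e(H) ≥ 1`), `hsDim_dualPoint` (`dim H* = dim_k 𝒟_e((L_B)_e)`), and `mizutani_prop25` packaging Prop. 2.5 for points.

References: H. Mizutani, Nagoya Math. J. 52 (1973), Def. 2.2, Lemma 2.3, Prop. 2.5, proof of Thm. 2.8 Step (I)
[Mizutani1973HironakaGroupSchemes]; T. Oda, Publ. RIMS 19 (1983), Thm. 2.2 (3), (3') [Oda1983HironakaGroupSchemeII].
-/

noncomputable section

open MvPolynomial Literature.AlgebraicGeometry.Resolution Literature.AlgebraicGeometry.Resolution.HironakaScheme
  Literature.RingTheory.MvPolynomial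

namespace Summit.ResolutionOfSingularities.KangarooAtlas.Mizutani

universe u

/-! ## The dual pair `V* = 𝒟_e(V)^⊥` -/

section DualForms

variable (k : Type u) [Field k] (p : ℕ) [hp : Fact p.Prime] [CharP k p] {n : ℕ} (e : ℕ)
  (V : Submodule k (Fin (n + 1) → k))

/-- **`V* = 𝒟_e(V)^⊥`** (Mizutani Def. 2.2), a subspace of `k ⊗_{k^q} W* = k^{n+1}` (dual basis coordinates).
[cite: Mizutani1973HironakaGroupSchemes, Def. 2.2 (V* = 𝒟_e(V)^⊥)] -/
def dualForms : Submodule k (Fin (n + 1) → k) := orth k (dSpan k p e V)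

/-- `V* = 𝒥_e(V^⊥)` (Lemma 2.3). [cite: Mizutani1973HironakaGroupSchemes, Lemma 2.3] -/
theorem dualForms_eq_jCore_orth : dualForms k p e V = jCore k p e (orth k V) := (jCore_orth k p e V).symm

/-- **(i*) holds for every `V`**: `𝒥_e𝒟_e(V*) = V*`. [cite: Mizutani1973HironakaGroupSchemes, Prop. 2.5 ((i) ⟺ (i*))] -/
theorem jCore_dSpan_dualForms : jCore k p e (dSpan k p e (dualForms k p e V)) = dualForms k p e V := by
  rw [dualForms_eq_jCore_orth, jCore_dSpan_jCore]

variable {V}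

/-- For closed `V`: **`𝒟_e(V*) = V^⊥`** (`𝒟𝒥(V^⊥) = (𝒥𝒟 V)^⊥`). [cite: Mizutani1973HironakaGroupSchemes, proof of Prop. 2.5 (𝒟_e^*(V*) = 𝒥_e𝒟_e(V)^⊥ = V^⊥)] -/
theorem dSpan_dualForms (hV : jCore k p e (dSpan k p e V) = V) : dSpan k p e (dualForms k p e V) = orth k V := by
  have h1 : orth k (jCore k p e (orth k V)) = dSpan k p e V := by rw [orth_jCore, orth_orth]
  rw [dualForms_eq_jCore_orth, dSpan_eq_orth_jCore_orth, h1, hV]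

/-- **`V** = V`** for closed `V` («H** = H»). [cite: Mizutani1973HironakaGroupSchemes, Prop. 2.5 ("H** = H")] -/
theorem dualForms_dualForms (hV : jCore k p e (dSpan k p e V) = V) : dualForms k p e (dualForms k p e V) = V := by
  show orth k (dSpan k p e (dualForms k p e V)) = V
  rw [dSpan_dualForms k p e hV, orth_orth]

variable (V)

/-- `V*` is proper iff `V ≠ 0`. [cite: Mizutani1973HironakaGroupSchemes, (*) (ii*)] -/
theorem dualForms_ne_top_iff : dualForms k p e V ≠ ⊤ ↔ V ≠ ⊥ := by
  unfold dualForms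
  rw [Ne, orth_eq_top_iff, not_iff_not]
  constructor
  · intro h; rw [eq_bot_iff, ← h]; exact le_dSpan k p e V
  · rintro rfl; exact dSpan_bot k p e

/-- `dim V* + dim 𝒟_e(V) = n + 1` («`dim H* = codim V*` = `dim 𝒟_e(V)`»). [cite: Mizutani1973HironakaGroupSchemes, proof of Thm. 2.8, Step (I) (codim 𝒟_1(f) = dim (k·f)*)] -/
theorem finrank_dualForms_add : Module.finrank k (dualForms k p e V) + Module.finrank k (dSpan k p e V) = n + 1 := by
  unfold dualForms
  rw [finrank_orth]
  have := Submodule.finrank_le (dSpan k p e V)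
  rw [Module.finrank_fintype_fun_eq_card, Fintype.card_fin] at this
  omega

variable {V}

/-- **(iii) ⟺ (iii*)**: for closed `V` at level `e + 1`, `V*` is defined over `k^p` (spanned by its vectors with coordinates in
`k^p`) iff `V` is — Frobenius descent of `𝒟_{e+1}`, `𝒥_{e+1}` and `⊥`. [cite: Mizutani1973HironakaGroupSchemes, Prop. 2.5 ((iii) ⟺ (iii*))] -/
theorem dualForms_eq_span_inter_iff (hV : jCore k p (e + 1) (dSpan k p (e + 1) V) = V) :
    dualForms k p (e + 1) V = Submodule.span k ((dualForms k p (e + 1) V : Set (Fin (n + 1) → k)) ∩ Set.range (frobVec k p 1)) ↔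
      V = Submodule.span k ((V : Set (Fin (n + 1) → k)) ∩ Set.range (frobVec k p 1)) := by
  constructor
  · intro h
    have h1 := dSpan_succ_eq_span_inter k p e h
    rw [dSpan_dualForms k p (e + 1) hV] at h1
    have h2 := orth_eq_span_inter k p h1
    rwa [orth_orth] at h2
  · intro h
    rw [dualForms_eq_jCore_orth]
    exact jCore_succ_eq_span_inter k p e (orth_eq_span_inter k p h)

end DualForms

/-! ## The dual point of a point of `ℙ^n_k` -/

section DualPoint

variable (k : Type u) [Field k] (p : ℕ) [hp : Fact p.Prime] [CharP k p] {n : ℕ}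
  (𝔭 : Ideal (MvPolynomial (Fin (n + 1)) k)) (e : ℕ)

/-- **The dual point `𝔭*` at level `e`**: the `q`-linear point of `(L_B)_e(𝔭)^⊥`, i.e. the generic point of the preimage under
`x ↦ x^q` of the linear space `{x : a·x = 0 ∀ … }^⊥ = ℙ((L_B)_e(𝔭))` cut out by the linear forms with coefficients `⊥ (L_B)_e(𝔭)`.
For the extremal points `[c^{1/p}]` this is the dual point `[a^{1/p}]` of `MizutaniExtremalDual`.
[cite: Mizutani1973HironakaGroupSchemes, Def. 2.2 and Prop. 2.5 (the dual H-scheme H*)] -/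
def dualPoint : Ideal (MvPolynomial (Fin (n + 1)) k) := qLinPoint k p e (orth k (invForms k p 𝔭 e))

/-- `𝔭*` is prime. [folklore] -/
theorem isPrime_dualPoint : (dualPoint k p 𝔭 e).IsPrime := isPrime_qLinPoint k p e _

/-- **`(L_B)_e(𝔭*) = V*`** for `V = (L_B)_e(𝔭)`. [cite: Mizutani1973HironakaGroupSchemes, Def. 2.2] -/
theorem invForms_dualPoint : invForms k p (dualPoint k p 𝔭 e) e = dualForms k p e (invForms k p 𝔭 e) := by
  unfold dualPoint
  rw [invForms_qLinPoint, dualForms_eq_jCore_orth]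

/-- `𝔭*` is a point iff `(L_B)_e(𝔭) ≠ 0`. [cite: Mizutani1973HironakaGroupSchemes, Prop. 2.5 ((ii*))] -/
theorem isPoint_dualPoint_iff : IsPoint k (dualPoint k p 𝔭 e) ↔ invForms k p 𝔭 e ≠ ⊥ := by
  unfold dualPoint
  rw [isPoint_qLinPoint_iff, Ne, orth_eq_top_iff]

/-- `exponent B(𝔭*) ≤ e`. [cite: Mizutani1973HironakaGroupSchemes, Prop. 2.5] -/
theorem exponentLE_dualPoint : ExponentLE k p (dualPoint k p 𝔭 e) e := exponentLE_qLinPoint k p e _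

/-- **`𝔭** = genPoint k p 𝔭 e`**: the double dual point is the MOST GENERIC point of `B(𝔭)` («H** = H»).
[cite: Mizutani1973HironakaGroupSchemes, Prop. 2.5 ("H** = H") and §1 (d)] -/
theorem dualPoint_dualPoint [𝔭.IsPrime] (hP : IsPoint k 𝔭) : dualPoint k p (dualPoint k p 𝔭 e) e = genPoint k p 𝔭 e := by
  show qLinPoint k p e (orth k (invForms k p (dualPoint k p 𝔭 e) e)) = _
  rw [invForms_dualPoint]
  show qLinPoint k p e (orth k (orth k (dSpan k p e (invForms k p 𝔭 e)))) = _
  rw [orth_orth, genPoint_eq_qLinPoint_dSpan k p 𝔭 e hP]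

/-- Hence `B(𝔭**) = B(𝔭)` when `exponent B(𝔭) ≤ e`. [cite: Mizutani1973HironakaGroupSchemes, Prop. 2.5 ("H** = H")] -/
theorem bIdeal_dualPoint_dualPoint [𝔭.IsPrime] (hP : IsPoint k 𝔭) (hE : ExponentLE k p 𝔭 e) :
    (haveI := isPrime_dualPoint k p (dualPoint k p 𝔭 e) e; bIdeal k (dualPoint k p (dualPoint k p 𝔭 e) e)) = bIdeal k 𝔭 := by
  haveI := isPrime_dualPoint k p (dualPoint k p 𝔭 e) e
  haveI := isPrime_genPoint k p 𝔭 e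
  have h := dualPoint_dualPoint k p 𝔭 e hP
  have hb := bIdeal_genPoint_eq k p 𝔭 e hP hE
  revert hb
  generalize genPoint k p 𝔭 e = 𝔤 at h
  subst h
  exact id

/-- `dim B(𝔭*)` read at level `e` is `dim_k 𝒟_e((L_B)_e(𝔭))` (= the codimension of `V*`).
[cite: Mizutani1973HironakaGroupSchemes, proof of Thm. 2.8, Step (I) ("2p − 1 ≤ dim H* < 2p, hence codim 𝒟_1(f) = dim (k·f)* = 1")] -/
theorem hsDimAt_dualPoint : hsDimAt k p (dualPoint k p 𝔭 e) e = Module.finrank k (dSpan k p e (invForms k p 𝔭 e)) := by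
  unfold hsDimAt
  rw [invForms_dualPoint]
  have := finrank_dualForms_add k p e (invForms k p 𝔭 e)
  omega

/-- A point of exponent `e + 1` has a nonzero invariant form of level `e + 1`. [folklore] -/
theorem invForms_ne_bot_of_exponent_eq_succ [𝔭.IsPrime] (he : exponent k p 𝔭 = e + 1) : invForms k p 𝔭 (e + 1) ≠ ⊥ := by
  intro h
  have hE : ExponentLE k p 𝔭 (e + 1) := (exponent_le_iff k p 𝔭).mp he.le
  have hspan : Submodule.span k (frobVec k p 1 '' (invForms k p 𝔭 e : Set (Fin (n + 1) → k))) = ⊥ :=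
    eq_bot_iff.mpr (h ▸ span_frobVec_image_le k p 𝔭 (Ideal.IsPrime.ne_top inferInstance) e)
  have hle : exponent k p 𝔭 ≤ e :=
    (exponent_le_iff k p 𝔭).mpr (exponentLE_of_succ_eq k p 𝔭 hE (h.trans hspan.symm))
  omega

/-- **`e(H*) = e(H)`**: for a point `𝔭` with `exponent B(𝔭) = e + 1 ≥ 1`, the dual point `𝔭*` at level `e + 1` is a point with
`exponent B(𝔭*) = e + 1` (exponent `≤ e + 1` by construction; not `≤ e` by (iii) ⟺ (iii*) and Frobenius descent).
[cite: Mizutani1973HironakaGroupSchemes, Prop. 2.5 ("Evidently we have e(H) = e(H*)")] -/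
theorem exponent_dualPoint [𝔭.IsPrime] (hP : IsPoint k 𝔭) (he : exponent k p 𝔭 = e + 1) :
    exponent k p (dualPoint k p 𝔭 (e + 1)) = e + 1 := by
  haveI := isPrime_dualPoint k p 𝔭 (e + 1)
  have hE : ExponentLE k p 𝔭 (e + 1) := (exponent_le_iff k p 𝔭).mp he.le
  have hD : IsPoint k (dualPoint k p 𝔭 (e + 1)) :=
    (isPoint_dualPoint_iff k p 𝔭 (e + 1)).mpr (invForms_ne_bot_of_exponent_eq_succ k p 𝔭 e he)
  refine le_antisymm ((exponent_le_iff k p _).mpr (exponentLE_dualPoint k p 𝔭 (e + 1))) ?_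
  by_contra hlt
  push Not at hlt
  have hle : ExponentLE k p (dualPoint k p 𝔭 (e + 1)) e := (exponent_le_iff k p _).mp (by omega)
  have h1 := (exponentLE_iff_eq_span_inter_range k p (dualPoint k p 𝔭 (e + 1)) e hD (exponentLE_dualPoint k p 𝔭 (e + 1))).mp hle
  rw [invForms_dualPoint, dualForms_eq_span_inter_iff k p e (jCore_dSpan_invForms k p 𝔭 (e + 1))] at h1
  have h2 : exponent k p 𝔭 ≤ e := (exponent_le_iff k p 𝔭).mpr ((exponentLE_iff_eq_span_inter_range k p 𝔭 e hP hE).mpr h1)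
  omega

/-- **MIZUTANI'S PROP. 2.5 / DEF. 2.2 FOR EVERY POINT** of `ℙ^n_k` with `exponent B(𝔭) = e + 1 ≥ 1`: the dual point `𝔭*`
(at the level `e + 1`) is a point with `exponent B(𝔭*) = e + 1`, `(L_B)_{e+1}(𝔭*) = (𝒟_{e+1}(L_B)_{e+1}(𝔭))^⊥ = V*`, and
`𝔭** ⊆ 𝔭` is the most generic point of `B(𝔭)`: `B(𝔭**) = B(𝔭)` («`e(H) = e(H*)` and `H** = H`»).  AI-written; *AI review is weaker
than expert review*; not a resolution theorem. [cite: Mizutani1973HironakaGroupSchemes, Def. 2.2 and Prop. 2.5] -/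
theorem mizutani_prop25 [𝔭.IsPrime] (hP : IsPoint k 𝔭) (he : exponent k p 𝔭 = e + 1) :
    IsPoint k (dualPoint k p 𝔭 (e + 1)) ∧ exponent k p (dualPoint k p 𝔭 (e + 1)) = e + 1 ∧
      invForms k p (dualPoint k p 𝔭 (e + 1)) (e + 1) = orth k (dSpan k p (e + 1) (invForms k p 𝔭 (e + 1))) ∧
      dualPoint k p (dualPoint k p 𝔭 (e + 1)) (e + 1) = genPoint k p 𝔭 (e + 1) ∧
      dualPoint k p (dualPoint k p 𝔭 (e + 1)) (e + 1) ≤ 𝔭 ∧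
      (haveI := isPrime_dualPoint k p (dualPoint k p 𝔭 (e + 1)) (e + 1);
        bIdeal k (dualPoint k p (dualPoint k p 𝔭 (e + 1)) (e + 1))) = bIdeal k 𝔭 := by
  have hE : ExponentLE k p 𝔭 (e + 1) := (exponent_le_iff k p 𝔭).mp he.le
  refine ⟨(isPoint_dualPoint_iff k p 𝔭 (e + 1)).mpr (invForms_ne_bot_of_exponent_eq_succ k p 𝔭 e he),
    exponent_dualPoint k p 𝔭 e hP he, invForms_dualPoint k p 𝔭 (e + 1), dualPoint_dualPoint k p 𝔭 (e + 1) hP, ?_,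
    bIdeal_dualPoint_dualPoint k p 𝔭 (e + 1) hP hE⟩
  rw [dualPoint_dualPoint k p 𝔭 (e + 1) hP]
  exact genPoint_le_self k p 𝔭 (e + 1)

end DualPoint

end Summit.ResolutionOfSingularities.KangarooAtlas.Mizutani

end
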